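import Summits.QuantumFields.BalabanUV.Beta.EriceRemainderEnclosureHistoryAutonomyComparisonAffineProfile
import Summits.QuantumFields.BalabanUV.Beta.EriceRemainderEnclosureHistoryAutonomyMonotoneFlat

/-!
# EriceRemainderEnclosureHistoryAutonomyComparisonTwoAgesLemmas — (E59c) LEMMAS FOR «TWO AFFINE AGES FAR APART COMPARE AT ANY SIZE»: acceleration `√2`
# for EVERY term of an affine profile (`accel_sqrt_two`), the far-read weight (`mul_term_read_le_invSq`, `term_weight_far`), the SCALING OF THE COUPLING
# GAP under a fixed level gap (`gap_scaling`, `mul_le_mul_of_level_gap`, `one_sub_le_ratio_pow_four`), the OLD GAP OVER A SHORT WINDOW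
# (`old_gap_window`), the drops beyond the old age (`drop_far_le`) and the numerical assembly of the peeling argument (`peel_assembly`)

Cell `pub-balaban`, β-function sub-cell, BINDER row D4 «RemainderConst leaves for Bałaban's split» (`HOME/BINDER-OWNERS.md`; owner lineage `b2b-balaban-beta-an4`;
this file by co-owner #2 lineage `b2b-balaban-beta-d4-p2`, generation 51), β-FLOW TEAM duty (1), FREEZE (0) honoured (def-free; (E58b)'s `mul_invSq_add_le`,
(E41)'s `affine_monotone` ∕ `affine_floor` (the displayed lambda `b + Σ_{k<K} L_k·u_k`), (E48a)'s `strictAnti_of_memFlow`, (E43a)'s `…MonotoneFlat.le_of_one_div_sq_le'`, node U2's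
`invSq_eq_of_memFlow` ∕ `drive` ∕ `Sharpness.abs_sub_le_half_cube_mul` BY NAME; nothing restated).  Third station of gen 51; consumed by (E59d) `…ComparisonTwoAgesFar` (THE STEP for
`k₂ ≥ 21·k₁`) and (E59e) `…ComparisonTwoAges` (ANY two affine ages compare at ANY size).

HONEST FRAMING (page 1, verbatim and binding).  *"Discharging BetaPertH makes Bałaban's UV stability UNCONDITIONAL — a real constructive-QFT result; it is
NOT the continuum limit and NOT the Clay problem."*  THIS FILE DISCHARGES NOTHING OF THE KIND.  Elementary real analysis about an ABSTRACT affine functional on a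
box ]0,γ]^ℕ and pairs of box histories — hypotheses of a census, not facts; the form of Bałaban's (1.22) limit functional is NOT PRINTED ([I] p. 298; GAPS
G-t4-U2-1∕-2) and NOT asserted.  Row D4 class UNCHANGED (critical-path width 0; instance 0∕1; D4 DISCHARGE NO DATE).  HONEST DEPENDENCY: continuum YM on T⁴ ⇐
BetaPertH ∧ nine spine estimates (0/9 proved); BetaPertH ⇐ (D1) ∧ (D4) ∧ CAP+tail; G-an2-4 gates asym, D1 and NE2/3/4.

THE POINT (census sense (α)).  The peeling argument of (E59d) (see its header) needs four trajectory facts beyond (E58b): (a) EVERY term of an affine profile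
obeys the acceleration bound `L_k·k·h_k³ ≤ √2` at any sizes (§1: `k·L_k·h_{2k} ≤ a_k` and the concavity `a_{2k} ≤ 2a_k`); (b) a term read `n ≥ 1` scales
deeper weighs `L_k·h_{n+k}³ ≤ 1∕n` (§1); (c) THE GAP SCALING (§1–§2, pure algebra): one level gap `δ ≥ 0` applied at two scales with levels `a ≤ a″` produces
coupling gaps in ratio at least `(a∕a″)²` (`x − p = δ·x²p²∕(x+p)`), and along the trajectory `(a_k∕a_{k+l})² ≥ 1 − 2l∕k`; hence (d) `old_gap_window`: if the level
gap at `k + l` is at least the level gap at `k` minus `E`, the coupling gap at `k + l` is at least `(1 − 2l∕k)` times the gap at `k` minus `(h_k³∕2)·E`;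
(e) `drop_far_le`: with level gaps `≤ n·η`, the two-age drop read at any scale `n > k₂` is `≤ (η∕2)(3 + k₁∕k₂)`; (f) `peel_assembly`: the resulting numerical
inequality `√2 − 1∕2 + t + t(3+t)∕4 ≤ 1` for `t = k₁∕k₂ ≤ 1∕21`.

WHAT IS PROVED ([folklore]; 0 `def`, 0 sorry).  §1 `sum_pair`, **`mul_term_read_le_invSq`**, **`accel_sqrt_two`**, `term_weight_far`, **`gap_scaling`**, `sqrt_two_lt`.
§2 **`mul_le_mul_of_level_gap`**, **`one_sub_le_ratio_pow_four`**, **`old_gap_window`**, **`drop_far_le`**, `peel_assembly`.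
-/
noncomputable section
open Finset Set

namespace Summit.QuantumFields.BalabanUV.Beta.EriceRemainderEnclosureHistoryAutonomyComparisonTwoAgesLemmas


open Literature.MathematicalPhysics.QuantumFieldTheory.Balaban1983to89
open Literature.MathematicalPhysics.QuantumFieldTheory.Balaban1983to89.T4BetaStationary
open Literature.MathematicalPhysics.QuantumFieldTheory.Balaban1983to89.T4BetaFlowWellPosed
open Literature.MathematicalPhysics.QuantumFieldTheory.Balaban1983to89.T4BetaFlowWellPosed.Sharpness (abs_sub_le_half_cube_mul)
open Summit.QuantumFields.BalabanUV.Beta.EriceRemainderEnclosureHistoryAutonomyOrder (strictAnti_of_memFlow)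
open Summit.QuantumFields.BalabanUV.Beta.EriceRemainderEnclosureHistoryAutonomyComparisonExcess (excess_shift_le)
open Summit.QuantumFields.BalabanUV.Beta.EriceRemainderEnclosureHistoryAutonomyComparisonAffineProfile (increment_anti mul_invSq_add_le)
open Summit.QuantumFields.BalabanUV.Beta.EriceRemainderEnclosureHistoryAutonomyMonotone (affine_monotone affine_floor)
open Summit.QuantumFields.BalabanUV.Beta.EriceRemainderEnclosureHistoryAutonomyMonotoneFlat (le_of_one_div_sq_le')

variable {B' : (ℕ → ℝ) → ℝ} {γ b y : ℝ} {L : ℕ → ℝ} {K k₁ k₂ : ℕ} {h h' : ℕ → ℝ}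

/-! ## §1 Two-point sums; the far-read weight; acceleration `√2` for every profile term; the scaling of the coupling gap -/

/-- A profile supported on `{k₁, k₂} ⊆ range K`: `Σ_{k<K} L_k·f(k) = L_{k₁}·f(k₁) + L_{k₂}·f(k₂)`. [folklore] -/
theorem sum_pair (hk₁ : k₁ ∈ range K) (hk₂ : k₂ ∈ range K) (hne : k₁ ≠ k₂)
    (hsupp : ∀ k ∈ range K, k ≠ k₁ → k ≠ k₂ → L k = 0) (f : ℕ → ℝ) :
    ∑ k ∈ range K, L k * f k = L k₁ * f k₁ + L k₂ * f k₂ :=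
  sum_eq_add_of_mem k₁ k₂ hk₁ hk₂ hne fun c hc hcne => by rw [hsupp c hc hcne.1 hcne.2, zero_mul]

/-- **THE FAR-READ WEIGHT**: along a box solution of `B = b + Σ_{k<K} L_k·u_k` (`L ≥ 0`, `b > 0`) from any pin, for every profile age `k < K` and every
scale `n`: `n·L_k·h(n+k) ≤ 1∕h(n)²` (each of the first `n` increments reads at age `k` a coupling at least `h(n+k)`). [folklore] -/
theorem mul_term_read_le_invSq (hL : ∀ k, 0 ≤ L k) (hb : 0 < b) (hy : 0 < y) (hh : SeqBox γ h)
    (hf : MemFlow (fun u : ℕ → ℝ => b + ∑ k ∈ range K, L k * u k) y h) {k : ℕ} (hk : k ∈ range K) (n : ℕ) :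
    (n : ℝ) * (L k * h (n + k)) ≤ 1 / h n ^ 2 := by
  have hanti := (strictAnti_of_memFlow hb (affine_floor hL) hh hf).antitone
  rw [invSq_eq_of_memFlow hf n]
  unfold drive
  have hterm : ∀ l ∈ range n, L k * h (n + k) ≤ (fun u : ℕ → ℝ => b + ∑ k ∈ range K, L k * u k) (fun i => h (l + 1 + i)) := by
    intro l hl
    have hl' : l < n := mem_range.mp hl
    have h1 : L k * h (n + k) ≤ L k * h (l + 1 + k) := mul_le_mul_of_nonneg_left (hanti (by omega)) (hL k)
    have h2 : L k * h (l + 1 + k) ≤ ∑ κ ∈ range K, L κ * h (l + 1 + κ) :=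
      single_le_sum (f := fun κ => L κ * h (l + 1 + κ)) (fun κ _ => mul_nonneg (hL κ) (hh _).1.le) hk
    simp only
    linarith
  have hsum := sum_le_sum hterm
  rw [sum_const, card_range, nsmul_eq_mul] at hsum
  have : 0 < 1 / y ^ 2 := by positivity
  linarith

/-- **ACCELERATION `√2` FOR EVERY TERM OF AN AFFINE PROFILE**: `L_k·k·h(k)³ ≤ √2` along every box solution from every pin, WHATEVER the sizes — from
`k·L_k·h(2k) ≤ 1∕h(k)²` and the concavity `1∕h(2k)² ≤ 2∕h(k)²` (so `h(k) ≤ √2·h(2k)`).  ((E57a) `accel` proved `≤ 2` for one age.) [folklore] -/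
theorem accel_sqrt_two (hL : ∀ k, 0 ≤ L k) (hb : 0 < b) (hy : 0 < y) (hh : SeqBox γ h)
    (hf : MemFlow (fun u : ℕ → ℝ => b + ∑ k ∈ range K, L k * u k) y h) {k : ℕ} (hk : k ∈ range K) (hk1 : 1 ≤ k) :
    L k * k * h k ^ 3 ≤ Real.sqrt 2 := by
  have h1 := mul_term_read_le_invSq hL hb hy hh hf hk k
  have hc := mul_invSq_add_le (affine_monotone hL) hb (affine_floor hL) hy hh hf k k
  have hkpos : (0 : ℝ) < k := by exact_mod_cast hk1
  have hk0 := (hh k).1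
  have h2k := (hh (k + k)).1
  -- 1/h(2k)² ≤ 2/h(k)²
  have h2 : 1 / h (k + k) ^ 2 ≤ 2 * (1 / h k ^ 2) := by
    have : (k : ℝ) * (1 / h (k + k) ^ 2) ≤ (k : ℝ) * (2 * (1 / h k ^ 2)) := by rw [show ((k : ℝ) + k) = (k : ℝ) * 2 by ring] at hc; linarith
    exact le_of_mul_le_mul_left this hkpos
  -- h k ≤ √2 · h(2k)
  have h3 : h k ≤ Real.sqrt 2 * h (k + k) := by
    have e : h k ^ 2 ≤ 2 * h (k + k) ^ 2 := by
      rw [div_le_iff₀ (by positivity)] at h2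
      have : 2 * (1 / h k ^ 2) * h (k + k) ^ 2 = 2 * h (k + k) ^ 2 / h k ^ 2 := by ring
      rw [this, le_div_iff₀ (by positivity)] at h2
      linarith
    have := Real.sqrt_le_sqrt e
    rwa [Real.sqrt_sq hk0.le, Real.sqrt_mul (by norm_num), Real.sqrt_sq h2k.le] at this
  have h4 : (k : ℝ) * (L k * h (k + k)) * h k ^ 2 ≤ 1 := by
    have := mul_le_mul_of_nonneg_right h1 (sq_nonneg (h k))
    rwa [one_div_mul_cancel (by positivity)] at this
  have h5 : 0 ≤ (k : ℝ) * (L k * h k ^ 2) := by have := hL k; positivity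
  calc L k * k * h k ^ 3 = (k : ℝ) * (L k * h k ^ 2) * h k := by ring
    _ ≤ (k : ℝ) * (L k * h k ^ 2) * (Real.sqrt 2 * h (k + k)) := mul_le_mul_of_nonneg_left h3 h5
    _ = Real.sqrt 2 * ((k : ℝ) * (L k * h (k + k)) * h k ^ 2) := by ring
    _ ≤ Real.sqrt 2 * 1 := mul_le_mul_of_nonneg_left h4 (Real.sqrt_nonneg _)
    _ = Real.sqrt 2 := mul_one _

/-- THE WEIGHT OF A TERM READ `n ≥ 1` SCALES DEEPER: `L_k·h(n+k)³ ≤ 1∕n`, hence `L_k·(h(n+k)³∕2)·((n+k)·η) ≤ (η∕2)·(n+k)∕n`. [folklore] -/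
theorem term_weight_far {η : ℝ} (hL : ∀ k, 0 ≤ L k) (hb : 0 < b) (hy : 0 < y) (hh : SeqBox γ h)
    (hf : MemFlow (fun u : ℕ → ℝ => b + ∑ k ∈ range K, L k * u k) y h) {k : ℕ} (hk : k ∈ range K) {n : ℕ} (hn : 1 ≤ n) (hη : 0 ≤ η) :
    L k * (h (n + k) ^ 3 / 2 * (((n + k : ℕ) : ℝ) * η)) ≤ η / 2 * (((n + k : ℕ) : ℝ) / n) := by
  have hanti := (strictAnti_of_memFlow hb (affine_floor hL) hh hf).antitone
  have h1 := mul_term_read_le_invSq hL hb hy hh hf hk n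
  have hnk := (hh (n + k)).1
  have hnpos : (0 : ℝ) < n := by exact_mod_cast hn
  -- 1/h n² ≤ 1/h(n+k)²
  have h2 : 1 / h n ^ 2 ≤ 1 / h (n + k) ^ 2 :=
    one_div_le_one_div_of_le (pow_pos hnk 2) (pow_le_pow_left₀ hnk.le (hanti (Nat.le_add_right n k)) 2)
  -- L k · h(n+k)³ ≤ 1/n
  have h3 : L k * h (n + k) ^ 3 ≤ 1 / n := by
    rw [le_div_iff₀ hnpos]
    have := mul_le_mul_of_nonneg_right (h1.trans h2) (sq_nonneg (h (n + k)))
    rw [one_div_mul_cancel (by positivity)] at this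
    calc L k * h (n + k) ^ 3 * n = (n : ℝ) * (L k * h (n + k)) * h (n + k) ^ 2 := by ring
      _ ≤ 1 := this
  have hpos : 0 ≤ ((n + k : ℕ) : ℝ) * η := by positivity
  calc L k * (h (n + k) ^ 3 / 2 * (((n + k : ℕ) : ℝ) * η)) = L k * h (n + k) ^ 3 * ((((n + k : ℕ) : ℝ) * η) / 2) := by ring
    _ ≤ 1 / n * ((((n + k : ℕ) : ℝ) * η) / 2) := mul_le_mul_of_nonneg_right h3 (by positivity)
    _ = η / 2 * (((n + k : ℕ) : ℝ) / n) := by ring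

/-- **THE SCALING OF THE COUPLING GAP** (pure algebra).  Two scales with levels `a ≤ a″` (couplings `x = a^{−1∕2} ≥ x″ = a″^{−1∕2}`) and ONE level gap
`δ ≥ 0` producing the couplings `p = (a+δ)^{−1∕2}`, `q = (a″+δ)^{−1∕2}`: in terms of the positive reals `x, p, x″, q` with `1∕p² − 1∕x² = 1∕q² − 1∕x″² = δ` and
`q·x ≥ x″·p` (i.e. `(a+δ)∕(a″+δ) ≥ a∕a″`), **`x″ − q ≥ (x″∕x)⁴·(x − p)`** — the gap at the deeper scale is at least `(a∕a″)²` times the gap at the shallower one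
(identity `x − p = δ·x²p²∕(x+p)`). [folklore] -/
theorem gap_scaling {x p x'' q δ : ℝ} (hx : 0 < x) (hp : 0 < p) (hx'' : 0 < x'') (hq : 0 < q) (hδ : 0 ≤ δ)
    (hpx : 1 / p ^ 2 - 1 / x ^ 2 = δ) (hqx : 1 / q ^ 2 - 1 / x'' ^ 2 = δ) (hxx : x'' ≤ x) (hpq : q ≤ p) (hkey : x'' * p ≤ q * x) :
    (x'' / x) ^ 4 * (x - p) ≤ x'' - q := by
  have e1 : x ^ 2 - p ^ 2 = δ * x ^ 2 * p ^ 2 := by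
    rw [← hpx]; field_simp
  have e2 : x'' ^ 2 - q ^ 2 = δ * x'' ^ 2 * q ^ 2 := by
    rw [← hqx]; field_simp
  have hsum : 0 < x + p := by positivity
  have hsum'' : 0 < x'' + q := by positivity
  have hcore : x'' ^ 2 * p ^ 2 * (x'' + q) ≤ q ^ 2 * x ^ 2 * (x + p) := by
    have h1 : x'' ^ 2 * p ^ 2 ≤ q ^ 2 * x ^ 2 := by nlinarith [mul_pos hx'' hp, mul_pos hq hx]
    have h2 : x'' + q ≤ x + p := add_le_add hxx hpq
    calc x'' ^ 2 * p ^ 2 * (x'' + q) ≤ q ^ 2 * x ^ 2 * (x'' + q) := mul_le_mul_of_nonneg_right h1 hsum''.le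
      _ ≤ q ^ 2 * x ^ 2 * (x + p) := mul_le_mul_of_nonneg_left h2 (by positivity)
  have l1 : (x'' / x) ^ 4 * (x - p) = δ * x'' ^ 4 * p ^ 2 / (x ^ 2 * (x + p)) := by
    have : x - p = (x ^ 2 - p ^ 2) / (x + p) := by field_simp; ring
    rw [this, e1]; field_simp
  have l2 : x'' - q = δ * x'' ^ 2 * q ^ 2 / (x'' + q) := by
    have : x'' - q = (x'' ^ 2 - q ^ 2) / (x'' + q) := by field_simp; ring
    rw [this, e2]
  rw [l1, l2, div_le_div_iff₀ (by positivity) hsum'']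
  calc δ * x'' ^ 4 * p ^ 2 * (x'' + q) = δ * x'' ^ 2 * (x'' ^ 2 * p ^ 2 * (x'' + q)) := by ring
    _ ≤ δ * x'' ^ 2 * (q ^ 2 * x ^ 2 * (x + p)) := mul_le_mul_of_nonneg_left hcore (by positivity)
    _ = δ * x'' ^ 2 * q ^ 2 * (x ^ 2 * (x + p)) := by ring

/-- `√2 < 1.4143`. [folklore] -/
theorem sqrt_two_lt : Real.sqrt 2 < 1.4143 := by
  rw [Real.sqrt_lt' (by norm_num)]; norm_num

/-! ## §2 The old gap over the young window; the drops beyond the old age; the numerical assembly -/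

/-- THE KEY PRODUCT INEQUALITY behind the gap scaling: couplings `x″ ≤ x` and the couplings `p`, `q` produced from them by ONE level gap `δ ≥ 0`
(`1∕p² = 1∕x² + δ`, `1∕q² = 1∕x″² + δ`) satisfy `x″·p ≤ q·x`. [folklore] -/
theorem mul_le_mul_of_level_gap {x p x'' q δ : ℝ} (hx : 0 < x) (hp : 0 < p) (hx'' : 0 < x'') (hq : 0 < q) (hδ : 0 ≤ δ)
    (hpx : 1 / p ^ 2 = 1 / x ^ 2 + δ) (hqx : 1 / q ^ 2 = 1 / x'' ^ 2 + δ) (hxx : x'' ≤ x) : x'' * p ≤ q * x := by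
  have ea : p ^ 2 * (1 / x ^ 2 + δ) = 1 := by rw [← hpx]; field_simp
  have eb : q ^ 2 * (1 / x'' ^ 2 + δ) = 1 := by rw [← hqx]; field_simp
  have hA : 0 < 1 / x ^ 2 + δ := by positivity
  have hB : 0 < 1 / x'' ^ 2 + δ := by positivity
  have key : x'' ^ 2 * (1 / x'' ^ 2 + δ) ≤ x ^ 2 * (1 / x ^ 2 + δ) := by
    have f1 : x'' ^ 2 * (1 / x'' ^ 2 + δ) = 1 + x'' ^ 2 * δ := by field_simp
    have f2 : x ^ 2 * (1 / x ^ 2 + δ) = 1 + x ^ 2 * δ := by field_simp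
    rw [f1, f2]; nlinarith [pow_le_pow_left₀ hx''.le hxx 2]
  have hsq : (x'' * p) ^ 2 ≤ (q * x) ^ 2 := by
    have e1 : (x'' * p) ^ 2 * ((1 / x ^ 2 + δ) * (1 / x'' ^ 2 + δ)) = x'' ^ 2 * (1 / x'' ^ 2 + δ) := by
      rw [mul_pow]; linear_combination (x'' ^ 2 * (1 / x'' ^ 2 + δ)) * ea
    have e2 : (q * x) ^ 2 * ((1 / x ^ 2 + δ) * (1 / x'' ^ 2 + δ)) = x ^ 2 * (1 / x ^ 2 + δ) := by
      rw [mul_pow]; linear_combination (x ^ 2 * (1 / x ^ 2 + δ)) * eb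
    rw [← e1, ← e2] at key
    exact le_of_mul_le_mul_right key (mul_pos hA hB)
  exact (pow_le_pow_iff_left₀ (by positivity) (by positivity) two_ne_zero).mp hsq

/-- THE FOURTH POWER OF THE COUPLING RATIO over a window: `1 − 2·(l∕k) ≤ (h(k+l)∕h(k))⁴` along a box solution of the affine memory
(concavity `k·a_{k+l} ≤ (k+l)·a_k`, Bernoulli). [folklore] -/
theorem one_sub_le_ratio_pow_four (hL : ∀ k, 0 ≤ L k) (hb : 0 < b) (hy : 0 < y) (hh : SeqBox γ h)
    (hf : MemFlow (fun u : ℕ → ℝ => b + ∑ k ∈ range K, L k * u k) y h) {k : ℕ} (hk1 : 1 ≤ k) (l : ℕ) :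
    1 - 2 * ((l : ℝ) / k) ≤ (h (k + l) / h k) ^ 4 := by
  have hc2 := mul_invSq_add_le (affine_monotone hL) hb (affine_floor hL) hy hh hf k l
  have hkr : (0 : ℝ) < k := by exact_mod_cast hk1
  have hk0 := (hh k).1
  have hm := (hh (k + l)).1
  have hlr : (0 : ℝ) ≤ l := Nat.cast_nonneg l
  set r : ℝ := (l : ℝ) / k with hr_def
  have hr0 : 0 ≤ r := div_nonneg hlr hkr.le
  have hlk : (l : ℝ) = r * k := by rw [hr_def]; field_simp
  have hsq : (k : ℝ) / ((k : ℝ) + l) ≤ (h (k + l) / h k) ^ 2 := by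
    rw [div_pow, div_le_div_iff₀ (by positivity) (by positivity)]
    have e1 : (k : ℝ) * (1 / h (k + l) ^ 2) * (h (k + l) ^ 2 * h k ^ 2) = (k : ℝ) * h k ^ 2 := by field_simp
    have e2 : ((k : ℝ) + l) * (1 / h k ^ 2) * (h (k + l) ^ 2 * h k ^ 2) = ((k : ℝ) + l) * h (k + l) ^ 2 := by field_simp
    have := mul_le_mul_of_nonneg_right hc2 (by positivity : (0 : ℝ) ≤ h (k + l) ^ 2 * h k ^ 2)
    rw [e1, e2] at this; linarith
  have ht : 1 - r ≤ (k : ℝ) / ((k : ℝ) + l) := by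
    rw [le_div_iff₀ (by positivity), hlk]
    have : 0 ≤ r * r * (k : ℝ) := by positivity
    nlinarith
  rcases le_or_gt 0 (1 - r) with hnn | hneg
  · calc 1 - 2 * r ≤ (1 - r) ^ 2 := by nlinarith [sq_nonneg r]
      _ ≤ ((h (k + l) / h k) ^ 2) ^ 2 := pow_le_pow_left₀ hnn (ht.trans hsq) 2
      _ = (h (k + l) / h k) ^ 4 := by ring
  · have : 1 - 2 * r ≤ 0 := by linarith
    linarith [pow_nonneg (div_nonneg hm.le hk0.le) 4]

/-- **THE OLD GAP IS NEARLY CONSTANT OVER A SHORT WINDOW.**  Along a box solution `h` of the affine memory and ANY box history `h′ ≤ h`: if the level gap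
at scale `k + l` is at least the level gap at scale `k ≥ 1` minus `E ≥ 0`, then the coupling gap satisfies
`h(k+l) − h′(k+l) ≥ (1 − 2·(l∕k))·(h(k) − h′(k)) − (h(k)³∕2)·E` (gap scaling at fixed level gap, the ratio bound above, and the coupling produced by a
smaller level gap exceeds by at most `(h³∕2)`·deficit). [folklore] -/
theorem old_gap_window (hL : ∀ k, 0 ≤ L k) (hb : 0 < b) (hy : 0 < y) (hh : SeqBox γ h)
    (hf : MemFlow (fun u : ℕ → ℝ => b + ∑ k ∈ range K, L k * u k) y h) (hh' : SeqBox γ h') (hle : ∀ j, h' j ≤ h j)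
    {k : ℕ} (hk1 : 1 ≤ k) (l : ℕ) {E : ℝ} (hE : 0 ≤ E)
    (hlev : (1 / h' k ^ 2 - 1 / h k ^ 2) - E ≤ 1 / h' (k + l) ^ 2 - 1 / h (k + l) ^ 2) :
    (1 - 2 * ((l : ℝ) / k)) * (h k - h' k) - h k ^ 3 / 2 * E ≤ h (k + l) - h' (k + l) := by
  have hanti := (strictAnti_of_memFlow hb (affine_floor hL) hh hf).antitone
  have hk0 := (hh k).1
  have hk0' := (hh' k).1
  have hm := (hh (k + l)).1
  have hm' := (hh' (k + l)).1
  have hmk : h (k + l) ≤ h k := hanti (Nat.le_add_right k l)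
  set δk : ℝ := 1 / h' k ^ 2 - 1 / h k ^ 2 with hδk_def
  have hδk0 : 0 ≤ δk := sub_nonneg.mpr (one_div_le_one_div_of_le (pow_pos hk0' 2) (pow_le_pow_left₀ hk0'.le (hle k) 2))
  -- the auxiliary coupling q = (a_{k+l} + δk)^{-1/2}
  have harg : 0 < 1 / h (k + l) ^ 2 + δk := by positivity
  set q : ℝ := 1 / Real.sqrt (1 / h (k + l) ^ 2 + δk) with hq_def
  have hq : 0 < q := by positivity
  have hq_sq : 1 / q ^ 2 = 1 / h (k + l) ^ 2 + δk := by
    rw [hq_def, one_div_pow, Real.sq_sqrt harg.le, one_div_one_div]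
  have hq_le : q ≤ h (k + l) := le_of_one_div_sq_le' hq hm (by rw [hq_sq]; linarith)
  have hq_le' : q ≤ h' k := le_of_one_div_sq_le' hq hk0' (by
    rw [hq_sq, hδk_def]
    have := one_div_le_one_div_of_le (pow_pos hm 2) (pow_le_pow_left₀ hm.le hmk 2)
    linarith)
  -- (i) h′(k+l) ≤ q + (h k³/2)·E
  have hi : h' (k + l) ≤ q + h k ^ 3 / 2 * E := by
    have hpos : 0 ≤ h k ^ 3 / 2 * E := by positivity
    rcases le_or_gt (1 / q ^ 2) (1 / h' (k + l) ^ 2) with hcase | hcase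
    · linarith [le_of_one_div_sq_le' hm' hq hcase]
    · have hw := abs_sub_le_half_cube_mul hm' hq (hle (k + l)) hq_le
      have hdiff : |1 / h' (k + l) ^ 2 - 1 / q ^ 2| ≤ E := by
        rw [abs_of_neg (by linarith), hq_sq]; linarith
      have h1 : h' (k + l) - q ≤ h (k + l) ^ 3 / 2 * E :=
        (le_abs_self _).trans (hw.trans (mul_le_mul_of_nonneg_left hdiff (by positivity)))
      have h2 : h (k + l) ^ 3 / 2 * E ≤ h k ^ 3 / 2 * E :=
        mul_le_mul_of_nonneg_right (by linarith [pow_le_pow_left₀ hm.le hmk 3]) hE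
      linarith
  -- (ii) gap scaling at the fixed level gap δk
  have hii : (h (k + l) / h k) ^ 4 * (h k - h' k) ≤ h (k + l) - q := by
    have hp' : 1 / h' k ^ 2 = 1 / h k ^ 2 + δk := by rw [hδk_def]; ring
    refine gap_scaling hk0 hk0' hm hq hδk0 (by rw [hδk_def]) (by rw [hq_sq]; ring) hmk hq_le' ?_
    exact mul_le_mul_of_level_gap hk0 hk0' hm hq hδk0 hp' hq_sq hmk
  -- (iii) the ratio bound
  have hiii := one_sub_le_ratio_pow_four hL hb hy hh hf hk1 l
  -- combine
  have hgap0 : 0 ≤ h k - h' k := by linarith [hle k]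
  have := mul_le_mul_of_nonneg_right hiii hgap0
  linarith

/-- **THE DROPS BEYOND THE OLD AGE ARE BOUNDED**: with level gaps `≤ n·η` at every scale `n`, for `n ≥ k₂ + 1` the drop read at scale `n`,
`L_{k₁}·(h(n+k₁) − h′(n+k₁)) + L_{k₂}·(h(n+k₂) − h′(n+k₂))`, is at most `(η∕2)·(3 + k₁∕k₂)` (`term_weight_far`). [folklore] -/
theorem drop_far_le {η : ℝ} (hL : ∀ k, 0 ≤ L k) (hb : 0 < b) (hy : 0 < y) (hh : SeqBox γ h)
    (hf : MemFlow (fun u : ℕ → ℝ => b + ∑ k ∈ range K, L k * u k) y h) (hh' : SeqBox γ h') (hle : ∀ j, h' j ≤ h j) (hη : 0 ≤ η)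
    (hδle : ∀ n : ℕ, 1 / h' n ^ 2 - 1 / h n ^ 2 ≤ (n : ℝ) * η)
    (hk₁K : k₁ ∈ range K) (hk₂K : k₂ ∈ range K) (hk : k₁ ≤ k₂) (hk₂1 : 1 ≤ k₂) {n : ℕ} (hn : k₂ + 1 ≤ n) :
    L k₁ * (h (n + k₁) - h' (n + k₁)) + L k₂ * (h (n + k₂) - h' (n + k₂)) ≤ η / 2 * (3 + (k₁ : ℝ) / k₂) := by
  have hn1 : 1 ≤ n := by omega
  have hnr : (0 : ℝ) < n := by exact_mod_cast hn1
  have hk₂r : (0 : ℝ) < k₂ := by exact_mod_cast hk₂1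
  have hgap : ∀ j : ℕ, h j - h' j ≤ h j ^ 3 / 2 * ((j : ℝ) * η) := by
    intro j
    have hw := abs_sub_le_half_cube_mul (hh j).1 (hh' j).1 le_rfl (hle j)
    have hδ0 : 0 ≤ 1 / h' j ^ 2 - 1 / h j ^ 2 :=
      sub_nonneg.mpr (one_div_le_one_div_of_le (pow_pos (hh' j).1 2) (pow_le_pow_left₀ (hh' j).1.le (hle j) 2))
    rw [abs_of_nonneg (by linarith [hle j]), abs_sub_comm, abs_of_nonneg hδ0] at hw
    exact hw.trans (mul_le_mul_of_nonneg_left (hδle j) (by have := (hh j).1; positivity))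
  have t : ∀ {k : ℕ}, k ∈ range K → L k * (h (n + k) - h' (n + k)) ≤ η / 2 * (((n + k : ℕ) : ℝ) / n) := by
    intro k hkK
    calc L k * (h (n + k) - h' (n + k)) ≤ L k * (h (n + k) ^ 3 / 2 * (((n + k : ℕ) : ℝ) * η)) := by
          have := hgap (n + k); exact mul_le_mul_of_nonneg_left this (hL k)
      _ ≤ η / 2 * (((n + k : ℕ) : ℝ) / n) := term_weight_far hL hb hy hh hf hkK hn1 hη
  have hnk₂ : (k₂ : ℝ) + 1 ≤ n := by exact_mod_cast hn
  have hk₁r : (0 : ℝ) ≤ k₁ := Nat.cast_nonneg k₁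
  have r1 : ((n + k₁ : ℕ) : ℝ) / n ≤ 1 + (k₁ : ℝ) / k₂ := by
    rw [Nat.cast_add, div_le_iff₀ hnr]
    have : (k₁ : ℝ) ≤ (k₁ : ℝ) / k₂ * n := by
      rw [div_mul_eq_mul_div, le_div_iff₀ hk₂r]; nlinarith
    linarith
  have r2 : ((n + k₂ : ℕ) : ℝ) / n ≤ 2 := by
    rw [Nat.cast_add, div_le_iff₀ hnr]; linarith
  have hη2 : 0 ≤ η / 2 := by positivity
  calc L k₁ * (h (n + k₁) - h' (n + k₁)) + L k₂ * (h (n + k₂) - h' (n + k₂))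
      ≤ η / 2 * (1 + (k₁ : ℝ) / k₂) + η / 2 * 2 :=
        add_le_add ((t hk₁K).trans (mul_le_mul_of_nonneg_left r1 hη2)) ((t hk₂K).trans (mul_le_mul_of_nonneg_left r2 hη2))
    _ = η / 2 * (3 + (k₁ : ℝ) / k₂) := by ring

/-- THE NUMERICAL ASSEMBLY of the peeling argument (pure arithmetic): with `c = √2∕2` (`c² = 1∕2`, `2c < 1.4143`), `t = k₁∕k₂ ≤ 1∕21`, the old drop
`X ≤ c·η`, the far-drop bound `D = (η∕2)(3 + t)`, the window bound `W = (1 − 2t)·X − c·t·D` and the young bound `Y ≤ c·η − c·W`: `Y + X ≤ η`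
(`√2 − 1∕2 + t + t(3+t)∕4 ≤ 1`). [folklore] -/
theorem peel_assembly {Y X W D η c t : ℝ} (hη : 0 ≤ η) (hc0 : 0 ≤ c) (hcc : c * c = 1 / 2) (hc1 : 2 * c < 1.4143)
    (ht0 : 0 ≤ t) (ht1 : t ≤ 1 / 21) (hXc : X ≤ c * η) (hD : D = η / 2 * (3 + t))
    (hW : W = (1 - 2 * t) * X - c * t * D) (hY : Y ≤ c * η - c * W) : Y + X ≤ η := by
  have hc1' : c ≤ 1 := by linarith
  have e1 : c * W = c * X - 2 * c * t * X - 1 / 2 * t * D := by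
    rw [hW]; linear_combination (-(t * D)) * hcc
  have i1 : Y + X ≤ c * η + (1 - c + 2 * c * t) * X + 1 / 2 * t * D := by
    have : (1 - c + 2 * c * t) * X = X - c * X + 2 * c * t * X := by ring
    linarith [this, e1]
  have hcoef : 0 ≤ 1 - c + 2 * c * t := by nlinarith
  have i2 : (1 - c + 2 * c * t) * X ≤ (1 - c + 2 * c * t) * (c * η) := mul_le_mul_of_nonneg_left hXc hcoef
  have e2 : c * η + (1 - c + 2 * c * t) * (c * η) + 1 / 2 * t * (η / 2 * (3 + t)) = η * (2 * c - 1 / 2 + t + t * (3 + t) / 4) := by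
    linear_combination (2 * t * η - η) * hcc
  have i3 : Y + X ≤ η * (2 * c - 1 / 2 + t + t * (3 + t) / 4) := by
    rw [← e2, ← hD]; linarith
  have hpoly : t * (3 + t) ≤ 1 / 21 * (3 + 1 / 21) := mul_le_mul ht1 (by linarith) (by linarith) (by norm_num)
  have hnum : 2 * c - 1 / 2 + t + t * (3 + t) / 4 ≤ 1 := by
    norm_num at hpoly ⊢; linarith
  calc Y + X ≤ η * (2 * c - 1 / 2 + t + t * (3 + t) / 4) := i3
    _ ≤ η * 1 := mul_le_mul_of_nonneg_left hnum hη
    _ = η := mul_one _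

end Summit.QuantumFields.BalabanUV.Beta.EriceRemainderEnclosureHistoryAutonomyComparisonTwoAgesLemmas

end
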